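import Mathlib
import HarnessLib
import HarnessLib.Audit
import Summits.CriticalPhenomena.Statement

/-!
Route: PercLevelPieceIsoperimetry

DORMANT since 2026-08-29T05:48:33Z (reconciler: no traction for 5 d (last activity statement-closed at 2026-08-24T03:51:39Z); parked, not closed — `ledger route dormant route-CriticalPhenomena-PercLevelPieceIsoperimetry --off` to reacti) — unstaffed, not closed; items shared with open routes are served there. `ledger route dormant <id> --off` reactivates.

# Route PercLevelPieceIsoperimetry — a jump forces γ ≥ D_iso — 3-dim isoperimetry of a percolating
cluster along its level pieces plus any γ<3 gives θ(p_c)=0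

It suffices to show X = I ∧ G3 [idea card
CriticalPhenomena/PercolationContinuityZ3/isoperimetry-plus-gamma-lt-3].
(I) LevelPieceIsoperimetry — work in the monotone label coupling (U_e i.i.d. uniform, ω_p = {U_e ≤
p}); for a percolating parameter p
(θ(p) > 0) the LEVEL PIECE S_ε = C_{p−ε}(0) ⊆ C_p(0) of the origin satisfies a 3-dimensional
isoperimetric inequality INSIDE C_p, in
probability as ε → 0: for every δ > 0 there are c, ε₀ > 0 with P(|C_p(0)| = ∞, S_ε finite, |∂_{C_p}
S_ε| < c |S_ε|^{2/3}) ≤ δ for all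
0 < ε < ε₀, where ∂_{C_p} S_ε = the p-open lattice edges with exactly one endpoint in S_ε (the
'exits' of the piece). Above p_c this is
continuity of θ on (p_c, 1] (van den Berg–Keane, Grimmett1999 Thm (8.8)); its content is the
hypothetical percolating point p = p_c.
(G3) SubcritChiBelowCube — ∃ γ₀ < 3, C with Σ_{x∈B(R)} τ_p(0,x) ≤ C (p_c − p)^{−γ₀} for all p < p_c
and all R (χ(p) ≤ C(p_c−p)^{−γ₀};
truth γ ≈ 1.79; the same declaration as PercDebrisSweep.SubcritChiBelowCube — one shared item).
Lean: `(∀ p : unitInterval, 0 < Literature.Probability.Percolation.theta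
(Literature.Probability.LatticeModels.zdGraph 3) 0 p → ∀ δ : ℝ, 0 < δ → ∃ c : ℝ, 0 < c ∧ ∃ ε₀ : ℝ, 0
< ε₀ ∧ ∀ ε : ℝ, 0 < ε → ε < ε₀ → (Literature.Probability.Percolation.labelMeasure
(Literature.Probability.LatticeModels.Site 3)).real {U |
(Literature.Probability.Percolation.openCluster (Literature.Probability.Percolation.configOfLabels
(p : ℝ) U (Literature.Probability.LatticeModels.zdGraph 3)) 0).Infinite ∧
(Literature.Probability.Percolation.openCluster (Literature.Probability.Percolation.configOfLabels
((p : ℝ) - ε) U (Literature.Probability.LatticeModels.zdGraph 3)) 0).Finite ∧ (({e : Sym2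
(Literature.Probability.LatticeModels.Site 3) | e ∈
Literature.Probability.Percolation.configOfLabels (p : ℝ) U
(Literature.Probability.LatticeModels.zdGraph 3) ∧ ∃ x ∈
Literature.Probability.Percolation.openCluster (Literature.Probability.Percolation.configOfLabels
((p : ℝ) - ε) U (Literature.Probability.LatticeModels.zdGraph 3)) 0, ∃ y ∉
Literature.Probability.Percolation.openCluster (Literature.Probability.Percolation.configOfLabels
((p : ℝ) - ε) U (Literature.Probability.LatticeModels.zdGraph 3)) 0, e = s(x, y)}.ncard : ℕ) : ℝ) <
c * ((Literature.Probability.Percolation.openCluster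
(Literature.Probability.Percolation.configOfLabels ((p : ℝ) - ε) U
(Literature.Probability.LatticeModels.zdGraph 3)) 0).ncard : ℝ) ^ ((2 : ℝ) / 3)} ≤ δ) ∧ (∃ γ C : ℝ,
γ < 3 ∧ (∀ p : unitInterval, (p : ℝ) < Literature.Probability.Percolation.criticalProb
(Literature.Probability.LatticeModels.zdGraph 3) 0 → ∀ R : ℕ, ∑ x ∈
Literature.Probability.LatticeModels.box 3 R, (Literature.Probability.Percolation.bondPercolation
(Literature.Probability.LatticeModels.zdGraph 3) p).real
(Literature.Probability.Percolation.openConn 0 x) ≤ C *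
(Literature.Probability.Percolation.criticalProb (Literature.Probability.LatticeModels.zdGraph 3) 0
- (p : ℝ)) ^ (-γ)))`

## Assembly
Pure composition of the two glue supports (checked sorry-free in the planner's Sketch.lean: `fun hI
hG => CubeAnnouncementClosesRoute
(IsoperimetryForcesCubeAnnouncement hI) hG`): I gives the cube announcement of a jump below p_c,
which the first-moment bound from G3
forbids; so θ(p_c) = 0. Standard reductions used: monotone label coupling with the right marginals
(map_configOfLabels_holds, in tree),
θ = 0 below p_c (theta_eq_zero_of_lt_criticalProb_holds, in tree), 0 < p_c(ℤ³) < 1 (in tree),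
Markov's inequality, a binomial Chernoff bound.

Rationale: WHY THIS LINE. EXITS IDENTITY (exact, Markov property of the label coupling): conditionally on S_ε =
A, the labels on the lattice edge boundary ∂A are
i.i.d. uniform on (p−ε, 1], so the exits ∂_{C_p}S_ε form a Bernoulli(ε') subset of ∂A, ε' =
ε/(1−p+ε); hence |∂_{C_p}S_ε| ≲ 6ε'|S_ε|
and an isoperimetric DIMENSION D of C_p along its level pieces forces |S_ε| ≥ (c/6ε')^D. If θ(p_c) =
θ* > 0 this gives
P_{p_c−ε}(|C(0)| ≥ c'ε^{−3}) ≥ θ*/4 and χ(p_c−ε) ≥ c''ε^{−3}, i.e. a jump forces γ ≥ D = 3,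
contradicting G3; Newman's theorem
'jump ⇒ γ ≥ 2' (Newman1986; AizenmanKestenNewmanCMP1987 p.523; in tree via Hutchcroft2022Triangle
Thm 1.3,
real_clusterSizeGe_le_of_kl) is exactly the free case D = 2 of the same bookkeeping, so the line
trades one dimension of SAME-p cluster
isoperimetry (Pete2008, arXiv:1810.11239, CerfDembin2020 — geometric group theory / isoperimetric
profiles of random graphs, imported
here) against relaxing the subcritical target from γ < 2 to γ < 3 (the hyperscaling-free bound χ ≤
Cξ³ then suffices given ν < 1).
Versus the sibling PercDebrisSweep (same G3): the same-p partner there is the Kesten–Zhang tail of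
FINITE clusters and the glue a transfer
across p; here it is the internal geometry of the INFINITE cluster and the glue never leaves the
coupling. CerfDembin2020 Thm 1.2 shows
full anchored 3-isoperimetry of C_{p_c} fails in a jump world (BFS balls cut by a box, via BGN), so
the full statement is target-equivalent;
I asks it only along level pieces, whose Cheeger ratio is pinned at ≈ 6ε' by the identity — the
negatives index (one SAW statement) is not touched.

RANKED CRUXES. #2 LevelPieceIsoperimetry (crux) — card item I (= critical-cluster-threshold-one r3
in thinning form): for every p with θ(p) > 0 and every δ > 0 there are c > 0, ε₀ > 0 such that for 0
< ε < ε₀, under i.i.d. uniform labels, P( C_p(0) infinite ∧ S_ε := C_{p−ε}(0) finite ∧ #{p-open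
edges with exactly one endpoint in S_ε} < c·|S_ε|^{2/3} ) ≤ δ. Vacuous/known for p > p_c (θ(p) −
θ(p−ε) → 0, Grimmett1999 Thm (8.8)); content at a percolating p_c, where S_ε is a.s. finite.
[difficulty: open-problem] (why it might fail: Content sits at a percolating p_c, where the minimal
consistent jump table (γ_j=2, ν_j=2/3: Newman+CCFS corner) has level pieces of volume ε⁻² and
iso-dimension 2, so I fails there and needs a GM-free same-p isoperimetry (known only sprinkled:
Pete2008, Dembin).) [Newman1986, Pete2008, CerfDembin2020, arXiv:1810.11239, Hutchcroft2020,
Grimmett1999, ChayesEtAl1986]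
#3 SubcritChiBelowCube (crux) — card item G3 (shared verbatim with
PercDebrisSweep.SubcritChiBelowCube): there are γ₀ < 3 and C such that for every p < p_c(ℤ³) and
every R, Σ_{x ∈ B(R)} τ_p(0,x) ≤ C (p_c − p)^{−γ₀} (uniform bound on the partial sums of χ(p)).
Truth γ ≈ 1.79; rigorous γ ≥ 1 (AizenmanNewman1984); in a jump world γ ≥ 2 (Newman1986), so the
content for this route is the window [2, 3). [difficulty: open-problem] (why it might fail: No upper
bound on γ is known for 3≤d≤6 (best χ ≤ Cξ³ ≤ exp(Cε⁻²), DKT 2020); Hutchcroft's γ ≤ δ−1 inputs a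
critical volume tail that already contains θ(p_c)=0; so γ₀<3 must come from a tail-free subcritical
method hitting the window [2,3).) [Newman1986, Hutchcroft2020, DuminilcopinKozmaTassion2020,
AizenmanNewman1984, arXiv:1901.10363]
#9 ExitsIdentity (support) — EXITS IDENTITY (provable now, ~250 lines; product structure of
labelMeasure + determinedBy_clusterIs): for 0 ≤ q ≤ p < 1, every finite A ⊆ ℤ³ and every F ⊆ ∂A
(lattice edge boundary), P^U( C_q(0) = A ∧ {p-open edges with exactly one endpoint in A} = F ) =
P^U( C_q(0) = A ) · ε'^{|F|} (1−ε')^{|∂A|−|F|} with ε' = (p−q)/(1−q), 1−ε' = (1−p)/(1−q): given the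
level-q piece, its p-exits are a Bernoulli(ε') subset of its lattice boundary. [difficulty:
provable-now] [Grimmett1999, doi:10.1017/9781316672815]
#9 IsoperimetryForcesCubeAnnouncement (support) — GLUE 1 (provable now given ExitsIdentity, ~500
lines): LevelPieceIsoperimetry ⇒ CUBE ANNOUNCEMENT: if θ* := θ(p_c) > 0 there are c, ε₀ > 0 with
P_p(|C(0)| ≥ m) ≥ c for all p < p_c with p_c − p < ε₀ and all m ≤ c (p_c − p)^{−3}. Proof: at p =
p_c take δ = θ*/4 in I; S_ε finite a.s. (θ(p_c−ε) = 0, theta_eq_zero_of_lt_criticalProb_holds); by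
ExitsIdentity P(S_ε = A, ≥ max(1, c|A|^{2/3}) exits) ≤ P_{p_c−ε}(C = A)·min(6ε'|A|, 2^{−c|A|^{2/3}})
for |A| ≤ m_ε := (c/(12e·ε'))³ (Chernoff), and C_{p_c}(0) infinite needs ≥ 1 exit; summing,
P_{p_c−ε}(|C(0)| > m_ε) ≥ θ* − θ*/4 − 6ε'K − 2^{−cK^{2/3}} ≥ θ*/4 for K(θ*, c) fixed and ε small;
marginals by map_configOfLabels_holds. [difficulty: provable-now] [Newman1986,
AizenmanKestenNewmanCMP1987, Hutchcroft2022Triangle]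
#9 CubeAnnouncementClosesRoute (support) — GLUE 2 (provable now, ~250 lines): CUBE ANNOUNCEMENT →
SubcritChiBelowCube → PercolationContinuityZ3. Proof: if θ(p_c) > 0, Markov gives P_p(|C(0)| ≥ m) ≤
E_p|C(0)|/m = (sup_R Σ_{B(R)} τ_p)/m ≤ C (p_c−p)^{−γ₀}/m (expClusterSize_eq_tsum /
encard_eq_tsum_indicator in SusceptibilityGammaOne.lean); with m ≍ c (p_c−p)^{−3} and γ₀ < 3
(w.l.o.g. γ₀ ≥ 0) the right side → 0 as p ↑ p_c (p_c > 0: criticalProb_zd_pos), contradicting ≥ c;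
hence θ(p_c) = 0, i.e. PercolationContinuityZ3 (percolationContinuityZ3_iff, measureReal_nonneg).
[difficulty: provable-now] [Newman1986, Grimmett1999, AizenmanNewman1984]

TWO-LAYER PLAN. Foreseen glued splits (none filed now). (a) LevelPieceIsoperimetry ⇐
PieceGraphReformulation → SameP_CubeVolume → LevelPieceIsoperimetry is
NOT valid (volume ⇏ uniform-c isoperimetry); the honest resplit if provers prefer the naked form is
to RESTATE r2 as its p-blind volume
consequence 'θ(p)>0 ⇒ ∀δ ∃c,ε₀: P(C_p(0) infinite, |S_ε| < cε^{−3}) ≤ δ' (weaker, still closes via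
the same glue). (b) SubcritChiBelowCube ⇐
SubcritCorrLengthBelowOne (ξ(p) ≤ C(p_c−p)^{−ν₀}, ν₀ < 1; truth ν ≈ 0.88, rigorous ν_fs ≥ 2/3
ChayesEtAl1986) → ChiLeXiCubed (χ ≤ C'ξ(p)³,
Grimmett1999 §6.1-type a-priori bound, provable) → SubcritChiBelowCube. (c) The one-parameter family
behind the card: [level-piece
isoperimetric dimension ≥ D] ∧ [γ < D] closes for every D ∈ (2, 3]; D = 2 is Newman's free case
(partner γ < 2 = card newman-gamma-below-two);
an intermediate D (e.g. 5/2) is a candidate ALTERNATIVE route sharing the glue, not a child here.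

KILL CRITERIA. (i) SubcritChiBelowCube refuted (γ ≥ 3 rigorously on ℤ³; numerics say 1.79 — would be
sensational) ⇒ close refuted:SubcritChiBelowCube
(kills PercDebrisSweep too). (ii) LevelPieceIsoperimetry cannot be refuted outright without
exhibiting a jump; it is MOOTED if a soft
(KL/Le Cam-type) argument proves 'jump ⇒ γ_j ≥ 3' directly — then G3 alone closes and this route is
superseded by PercDebrisSweep's S;
(iii) conversely a Cerf–Dembin-type theorem ALONG LEVEL PIECES ('θ(p_c)>0 ⇒ level pieces fail
3-isoperimetry', e.g. from BGN + an
upper bound γ_j ≤ 3) makes I ⟺ the target: convert to an under-floor/conditional route or close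
superseded. (iv) A refuter shows the glue
needs the isoperimetric constant c uniform in δ (it does not, checked: only δ = θ*/4 is used) —
repair by restate.

NOT DECOMPOSED YET. The piece-graph reformulation (C_∞(p) = infinite cluster of Bernoulli(ε')
percolation on the lattice edges between (p−ε)-clusters — the
structural fact behind the identity) is left as prover's lemma (--supports LevelPieceIsoperimetry);
the van den Berg–Keane discharge of I
above p_c (Grimmett1999 Thm (8.8), not in tree, irrelevant for closing); Chernoff constants; the ν₀
< 1 child of G3; the parametric D;
any use of BGN/DST weaving to attack I (that is the prover's/refuter's business, see Kill (iii)).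

CHEAPEST FALSIFIER. Bookkeeping audit on the jump table J of card twenty-probes-no-contradiction
(minutes): I forces γ_j = Δ_j ≥ 3 while J's floor is
γ_j ≥ 2 — look for ANY catalogued rigorous inequality capping the announcement volume of a jump at
ε^{−2}·polylog (a converse to
Newman/KL: 'P_{p_c−ε}(|C| ≥ n) − θ* small for n ≫ ε^{−2}'); if one exists, I ⟺ ¬jump and the route
collapses to the under-floor one-crux
shape (pointless as filed). I found none (DKT gives only ξ ≤ exp(Cε^{−2})). Second: check I against
the two realised jump models — AN
1/r² chains (pieces are 1-dimensional: I false, as it must be, so finite range/d = 3 has to enter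
any proof of I) and large-q random-cluster
(label thinning is not the FK model at lower p: N/A). Numerics cannot test I: in the real
near-critical window level pieces have
iso-dimension D = Δ = β+γ ≈ 2.2, which I does not contradict (ε₀(p) ≤ p − p_c is allowed).

NUMBERS. p_c(ℤ³, bond) ≈ 0.2488; γ ≈ 1.79–1.82, ν ≈ 0.876, β ≈ 0.42, gap exponent Δ = β+γ ≈ 2.2, d_f
≈ 2.52 (numerics). Rigorous: γ ≥ 1
(AizenmanNewman1984), δ ≥ 2 and β ≤ 1 (Aizenman–Barsky), ν_fs ≥ 2/3 (ChayesEtAl1986), ξ(p) ≤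
exp(C|p−p_c|^{−2}) (DuminilcopinKozmaTassion2020);
in a jump world γ_j ≥ 2 via P_{p_c−ε}(|C| ≥ cθ*²ε^{−2}) ≥ 3θ*/4 (Newman1986; Hutchcroft2022Triangle
Thm 1.3 in tree). Exits identity
constants on ℤ³: |∂A| ≤ 6|A|, ε' = ε/(1−p+ε) ≤ 1.34ε at p = p_c. Isoperimetric profile for p > p_c:
n·φ_n(p) → φ(p) > 0 a.s.
(arXiv:1810.11239 Thm 1.1), and liminf n·φ̂_n(p_c) = 0 a.s. (CerfDembin2020 Thm 1.2). Items at open: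
6 (2 cruxes, 3 supports, 1 assembly).

DEFINITION REQUESTS. None: labelMeasure, configOfLabels, openCluster, edgeBoundary, theta,
criticalProb(I), bondPercolation, box all exist
(Literature.Probability.Percolation / .LatticeModels). Cite fact wanted later (not load-bearing):
van den Berg–Keane continuity of θ on
(p_c, 1] (Grimmett1999 Thm (8.8)). Newman1986 itself is cite-only (acq-00047).

Novelty: Searches (2026-08-15): `lit search --hybrid "anchored isoperimetric inequality infinite percolation
cluster"` (10 books: LyonsPeres2016,
Grimmett1999, Kesten1982 …, no level-piece statement); `lit search --source zbmath "anchored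
isoperimetric profile percolation"` (5: CerfDembin2020
doi:10.1214/19-ecp281, Biskup–Louidor–Procaccia–Rosenthal doi:10.1002/cpa.21558, Pete2008
doi:10.1214/ecp.v13-1390, Dembin arXiv:1810.11239,
doi:10.1214/20-ecp313); `lit search --source crossref "isoperimetric inequality infinite percolation
cluster"` (Procaccia–Rosenthal
doi:10.1214/ecp.v17-2185, Alves–Procacci–Sanchis doi:10.1007/s10955-012-0644-1 — all supercritical
or p_c<1 criteria);
`lit galaxy search "anchored isoperimetric" --star all` (2: LyonsPeres2016, a GW-tree paper) and
`"isoperimetric profile" --star all` (10,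
none on percolation at p_c); `lit frontier CriticalPhenomena --since 2020` (30 rows, nothing on jump
⇒ exponent via isoperimetry);
`lit bridges CriticalPhenomena --cross any`; CerfDembin2020 read in full (held text); Grimmett1999
p.291 (Newman 1987c γ ≥ 2(1−1/δ))
and Thm (8.8) read; arXiv/OpenAlex/S2 rate-limited today (card audit of 2026-08-15 covered them: AKN
p.523, LP Q 6.49, zbMATH).
Nearest prior art found: Newman1986 / AizenmanKestenNewmanCMP1987 p.523 (jump ⇒ γ ≥ 2, the D = 2
case); Pete2008 and arXiv:1810.11239
(anchored isoperimetry / profile of the supercritical cluster, via Grimmett–Marstrand);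
CerfDembin2020 Thm 1.2 (the anchored profile at p_c
vanishes along a s  [refs: 10.1214/19-ecp281, 10.1002/cpa.21558, 10.1214/ecp.v13-1390, 10.1214/20-ecp313, 10.1214/ecp.v17-2185, 10.1007/s10955-012-0644-1, 1810.11239, 1901.10363, doi:10.1214/19-ecp281, doi:10.1002/cpa.21558, doi:10.1214/ecp.v13-1390, doi:10.1214/20-ecp313, doi:10.1214/ecp.v17-2185, doi:10.1007/s10955-012-0644-1, LyonsPeres2016, Grimmett1999, Kesten1982, CerfDembin2020, Pete2008, Newman1986, AizenmanKestenNe]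

Barriers (technique_class: exponent-inequality isoperimetry same-p label-coupling): - technique_class: exponent-inequality isoperimetry same-p label-coupling
- Literature.Barriers.CriticalPhenomena.SprinklingRenormalisation: HEAD-ON for
LevelPieceIsoperimetry — every known cluster-isoperimetry theorem (Pete2008, Dembin) runs through
Grimmett–Marstrand blocks at p > p_c and delivers nothing at η = 0; declared in the item's
why-might-fail; the bet is that level pieces come with an exact same-p handle GM blocks lack (the
exits identity / piece-graph structure: C_∞(p) is Bernoulli(ε') percolation on the lattice edges
between (p−ε)-clusters), so that a density-θ(p)-only argument can bound piece volumes; G3 is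
subcritical and not concerned.
- Literature.Barriers.CriticalPhenomena.LongRangeDiscontinuity: in the Aizenman–Newman 1/r² chains
the density jumps and the level pieces of the critical cluster are (unions of) intervals with O(1)
exits — isoperimetric dimension 1, so I is FALSE there, as it must be: finite range and d = 3 enter
the line exactly through I (lattice isoperimetry |∂A| ≥ c|A|^{2/3} of the pieces' hulls and the
geometry of how pieces of volume ε^{−3} must tile a density-θ* cluster); the glue and G3's role are
range-insensitive, consistent with the barrier.
- Literature.Barriers.CriticalPhenomena.RandomClusterFirstOrder: evaded by mechanism — the exits
identity and the level-piece decomposition are PRODUCT-measure facts (i.i.d. labels); for the wired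
q > Q critical FK cluster lowering p is not i.i.d. thinning, the ordered phase has p_c(cluster) < 1

Novelty grade: new-combination — refuter gen-2 (rreview 10c13a27-g2, 2026-08-15): new-combination = (A) Newman's 'jump => gamma >= 2' bookkeeping (D=2) x (B) anchored isoperimetry of percolation clusters (Pete08, Dembin, Cerf-Dembin20), restricted to LEVEL PIECES of the label coupling, where the exits identity pins the Cheeger rati (refuter refuter-rreview-route-CriticalPhenomena--10c13a27-g2-0, 2026-08-15T14:49:03Z; prior: Newman1986 doi:10.1007/bf01021076 / AizenmanKestenNewmanCMP1987 p.523 (jump => gamma >= 2: the D=2 free case of the same bookkeeping; in tree via Hutchcroft2022Triangle Thm 1.3), Pete2008 doi:10.1214/ecp.v13-1390; Dembin arXiv:1810.11239; CerfDembin2020 doi:10.1214/19-ecp281 Thm 1.2 (anchored isoperimetry/profile of percolation clusters; supercritical via Grimmett-Marstrand; full 3-isoperimetry fa)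

History (route lifecycle, newest last):
- 2026-08-22T11:16:30Z · DORMANT — reconciler: no traction for 5.3 d (last activity item-evidence-added at 2026-08-17T03:44:18Z); parked, not closed — `ledger route dormant route-CriticalPhenomen (operator:999:2100403)
- 2026-08-23T14:57:30Z · REACTIVATED — reconciler: reactivated — activity statement-closed at 2026-08-23T13:22:10Z after parking at 2026-08-22T11:16:30Z (operator:999:1984015)
- 2026-08-29T05:48:33Z · DORMANT — reconciler: no traction for 5 d (last activity statement-closed at 2026-08-24T03:51:39Z); parked, not closed — `ledger route dormant route-CriticalPhenomena-Per (operator:999:1284018)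

sub-problem: PercolationContinuityZ3 · status: dormant · opened planner-plancard-CriticalPhenomena-Percolatio-d83d5fc6-0 2026-08-15T11:34:19Z · rev 2 · ledger route-CriticalPhenomena-PercLevelPieceIsoperimetry
GENERATED by the gate from the ledger (D-0016/17). Provers cite these decls: `theorem foo : Summit.CriticalPhenomena.PercolationContinuityZ3.Theses.PercLevelPieceIsoperimetry.<Decl> := …` in Summits/CriticalPhenomena/PercolationContinuityZ3/Theorems/<Name>.lean.
-/

namespace Summit.CriticalPhenomena.PercolationContinuityZ3.Theses.PercLevelPieceIsoperimetry

open scoped BigOperators Topology Manifold Classical MeasureTheory ProbabilityTheory Matrix InnerProductSpace ComplexConjugate ContinuousMap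
open Filter Set Function TopologicalSpace MeasureTheory

attribute [summit_statement] _root_.PercolationContinuityZ3

/-- item stmt-CriticalPhenomena-4475 · crux · rank 2 · closed · proved by Summit.CriticalPhenomena.PercolationContinuityZ3.Theorems.LevelPieceIsoperimetry.levelPieceIsoperimetry_proof @ 407af72c445a (prover) · by planner
why it might fail: Target-implied (θ(p_c)=0 + van den Berg–Keane), so irrefutable; its content 'jump ⇒ level pieces of C_{p_c}(0) have ≳ε⁻³ sites' fails in the unexcluded Newman/CCFS jump table (γ_j=2, ν_j=2/3: pieces ~ε⁻², iso-dim 2); all cluster isoperimetry in print (Pete2008, Dembin) is sprinkled (GM), void at p_c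
sources: Newman1986, Pete2008, CerfDembin2020, arXiv:1810.11239, Hutchcroft2020, Grimmett1999
[crux] card item I (= critical-cluster-threshold-one r3 in thinning form): for every p with θ(p) > 0
and every δ > 0 there are c > 0, ε₀ > 0 such that for 0 < ε < ε₀, under i.i.d. uniform labels, P(
C_p(0) infinite ∧ S_ε := C_{p−ε}(0) finite ∧ #{p-open edges with exactly one endpoint in S_ε} <
c·|S_ε|^{2/3} ) ≤ δ. Vacuous/known for p > p_c (θ(p) − θ(p−ε) → 0, Grimmett1999 Thm (8.8)); content
at a percolating p_c, where S_ε is a.s. finite. [difficulty: open-problem] -/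
@[route_item "route-CriticalPhenomena-PercLevelPieceIsoperimetry"]
def LevelPieceIsoperimetry : Prop :=
  ∀ p : unitInterval, 0 < Literature.Probability.Percolation.theta (Literature.Probability.LatticeModels.zdGraph 3) 0 p → ∀ δ : ℝ, 0 < δ → ∃ c : ℝ, 0 < c ∧ ∃ ε₀ : ℝ, 0 < ε₀ ∧ ∀ ε : ℝ, 0 < ε → ε < ε₀ → (Literature.Probability.Percolation.labelMeasure (Literature.Probability.LatticeModels.Site 3)).real {U | (Literature.Probability.Percolation.openCluster (Literature.Probability.Percolation.configOfLabels (p : ℝ) U (Literature.Probability.LatticeModels.zdGraph 3)) 0).Infinite ∧ (Literature.Probability.Percolation.openCluster (Literature.Probability.Percolation.configOfLabels ((p : ℝ) - ε) U (Literature.Probability.LatticeModels.zdGraph 3)) 0).Finite ∧ (({e : Sym2 (Literature.Probability.LatticeModels.Site 3) | e ∈ Literature.Probability.Percolation.configOfLabels (p : ℝ) U (Literature.Probability.LatticeModels.zdGraph 3) ∧ ∃ x ∈ Literature.Probability.Percolation.openCluster (Literature.Probability.Percolation.configOfLabels ((p : ℝ) - ε) U (Literature.Probability.LatticeModels.zdGraph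 3)) 0, ∃ y ∉ Literature.Probability.Percolation.openCluster (Literature.Probability.Percolation.configOfLabels ((p : ℝ) - ε) U (Literature.Probability.LatticeModels.zdGraph 3)) 0, e = s(x, y)}.ncard : ℕ) : ℝ) < c * ((Literature.Probability.Percolation.openCluster (Literature.Probability.Percolation.configOfLabels ((p : ℝ) - ε) U (Literature.Probability.LatticeModels.zdGraph 3)) 0).ncard : ℝ) ^ ((2 : ℝ) / 3)} ≤ δ

-- `LevelPieceIsoperimetry` holds: proved by `Summit.CriticalPhenomena.PercolationContinuityZ3.Theorems.LevelPieceIsoperimetry.levelPieceIsoperimetry_proof` @ 407af72c445a (its module imports this route file, so no `_holds` link can be stated here).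

/-- item stmt-CriticalPhenomena-0942 · crux · rank 3 · open · by planner
why it might fail: No upper bound on γ is known on ℤ^d, 3≤d≤6 (rigorous: γ≥1 AizenmanNewman1984; χ ≤ Cξ³ ≤ exp(Cε⁻²), DKT2020); Hutchcroft2020's γ ≤ δ−1 inputs a critical volume tail that already contains θ(p_c)=0; in a jump world γ≥2 (Newman1986), so γ₀<3 needs a tail-free subcritical method landing in [2,3).
sources: Newman1986, Hutchcroft2020, DuminilcopinKozmaTassion2020, AizenmanNewman1984, arXiv:1901.10363
[crux] r2 (S): susceptibility exponent below 3 on Z^3: ∃ γ0 < 3, C with sum_{x in B(R)} tau_p(0,x)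
<= C (p_c - p)^{-γ0} for all p < p_c and all R (uniform bound on the partial sums = chi(p) <= C
(p_c-p)^{-γ0}; chi := Literature SusceptibilityGammaOne.chi not used to keep the cone minimal).
Truth gamma ~ 1.79, nu ~ 0.88; rigorous: gamma >= 1 (Aizenman-Newman mean-field bound), and IN A
JUMP WORLD gamma >= 2 (Newman1986) — so the content of this crux for the route is the window 2 <= γ0
< 3. Shared target in spirit with cards isoperimetry-plus-gamma-lt-3 (G3) and
two-arms-exponent-amplifier. Tools: reversed Simon-Lieb / random-walk comparison
(DuminilCopinPanis2024), OSSS differential inequalities, DKT finite-size scheme (arXiv:1902.03207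
gives only log chi <~ eps^{-2}). Sources: Newman1986 doi:10.1007/bf01021076;
AizenmanBarskyFernandez1987; DuminilcopinKozmaTassion2020; Hutchcroft arXiv:1901.10363 Thm 1.1
(conditional gamma bounds). -/
@[route_item "route-CriticalPhenomena-PercLevelPieceIsoperimetry"]
def SubcritChiBelowCube : Prop :=
  ∃ γ C : ℝ, γ < 3 ∧ (∀ p : unitInterval, (p : ℝ) < Literature.Probability.Percolation.criticalProb (Literature.Probability.LatticeModels.zdGraph 3) 0 → ∀ R : ℕ, ∑ x ∈ Literature.Probability.LatticeModels.box 3 R, (Literature.Probability.Percolation.bondPercolation (Literature.Probability.LatticeModels.zdGraph 3) p).real (Literature.Probability.Percolation.openConn 0 x) ≤ C * (Literature.Probability.Percolation.criticalProb (Literature.Probability.LatticeModels.zdGraph 3) 0 - (p : ℝ)) ^ (-γ))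

/-- item stmt-CriticalPhenomena-4476 · support · rank 9 · closed · proved by Summit.CriticalPhenomena.PercolationContinuityZ3.Theorems.ExitsIdentity.exitsIdentity_proof @ 8a45466b0e22 (prover) · by planner
sources: Grimmett1999, doi:10.1017/9781316672815
[support] EXITS IDENTITY (provable now, ~250 lines; product structure of labelMeasure +
determinedBy_clusterIs): for 0 ≤ q ≤ p < 1, every finite A ⊆ ℤ³ and every F ⊆ ∂A (lattice edge
boundary), P^U( C_q(0) = A ∧ {p-open edges with exactly one endpoint in A} = F ) = P^U( C_q(0) = A )
· ε'^{|F|} (1−ε')^{|∂A|−|F|} with ε' = (p−q)/(1−q), 1−ε' = (1−p)/(1−q): given the level-q piece, its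
p-exits are a Bernoulli(ε') subset of its lattice boundary. [difficulty: provable-now] -/
@[route_item "route-CriticalPhenomena-PercLevelPieceIsoperimetry"]
def ExitsIdentity : Prop :=
  ∀ p q : ℝ, 0 ≤ q → q ≤ p → p < 1 → ∀ A : Finset (Literature.Probability.LatticeModels.Site 3), ∀ F : Finset (Sym2 (Literature.Probability.LatticeModels.Site 3)), F ⊆ Literature.Probability.LatticeModels.edgeBoundary (Literature.Probability.LatticeModels.zdGraph 3) A → (Literature.Probability.Percolation.labelMeasure (Literature.Probability.LatticeModels.Site 3)).real {U | Literature.Probability.Percolation.openCluster (Literature.Probability.Percolation.configOfLabels q U (Literature.Probability.LatticeModels.zdGraph 3)) 0 = ↑A ∧ {e : Sym2 (Literature.Probability.LatticeModels.Site 3) | e ∈ Literature.Probability.Percolation.configOfLabels p U (Literature.Probability.LatticeModels.zdGraph 3) ∧ ∃ x ∈ (A : Set (Literature.Probability.LatticeModels.Site 3)), ∃ y ∉ (A : Set (Literature.Probability.LatticeModels.Site 3)), e = s(x, y)} = ↑F} = (Literature.Probability.Percolation.labelMeasure (Literature.Probability.LatticeModels.Site 3)).real {U | Literature.Probability.Percolation.openCluster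 (Literature.Probability.Percolation.configOfLabels q U (Literature.Probability.LatticeModels.zdGraph 3)) 0 = ↑A} * ((p - q) / (1 - q)) ^ F.card * ((1 - p) / (1 - q)) ^ ((Literature.Probability.LatticeModels.edgeBoundary (Literature.Probability.LatticeModels.zdGraph 3) A).card - F.card)

-- `ExitsIdentity` holds: proved by `Summit.CriticalPhenomena.PercolationContinuityZ3.Theorems.ExitsIdentity.exitsIdentity_proof` @ 8a45466b0e22 (its module imports this route file, so no `_holds` link can be stated here).

/-- item stmt-CriticalPhenomena-4477 · support · rank 9 · closed · proved by Summit.CriticalPhenomena.PercolationContinuityZ3.Theorems.PercLevelPieceIsoperimetryIsoperimetryForcesCubeAnnouncement.isoperimetryForcesCubeAnnouncement_proof @ a6ae0b31789a (prover) · by planner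
sources: Newman1986, AizenmanKestenNewmanCMP1987, Hutchcroft2022Triangle
[support] GLUE 1 (provable now given ExitsIdentity, ~500 lines): LevelPieceIsoperimetry ⇒ CUBE
ANNOUNCEMENT: if θ* := θ(p_c) > 0 there are c, ε₀ > 0 with P_p(|C(0)| ≥ m) ≥ c for all p < p_c with
p_c − p < ε₀ and all m ≤ c (p_c − p)^{−3}. Proof: at p = p_c take δ = θ*/4 in I; S_ε finite a.s.
(θ(p_c−ε) = 0, theta_eq_zero_of_lt_criticalProb_holds); by ExitsIdentity P(S_ε = A, ≥ max(1,
c|A|^{2/3}) exits) ≤ P_{p_c−ε}(C = A)·min(6ε'|A|, 2^{−c|A|^{2/3}}) for |A| ≤ m_ε := (c/(12e·ε'))³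
(Chernoff), and C_{p_c}(0) infinite needs ≥ 1 exit; summing, P_{p_c−ε}(|C(0)| > m_ε) ≥ θ* − θ*/4 −
6ε'K − 2^{−cK^{2/3}} ≥ θ*/4 for K(θ*, c) fixed and ε small; marginals by map_configOfLabels_holds.
[difficulty: provable-now] -/
@[route_item "route-CriticalPhenomena-PercLevelPieceIsoperimetry"]
def IsoperimetryForcesCubeAnnouncement : Prop :=
  LevelPieceIsoperimetry → 0 < Literature.Probability.Percolation.theta (Literature.Probability.LatticeModels.zdGraph 3) 0 (Literature.Probability.Percolation.criticalProbI 3) → ∃ c : ℝ, 0 < c ∧ ∃ ε₀ : ℝ, 0 < ε₀ ∧ ∀ p : unitInterval, (p : ℝ) < Literature.Probability.Percolation.criticalProb (Literature.Probability.LatticeModels.zdGraph 3) 0 → Literature.Probability.Percolation.criticalProb (Literature.Probability.LatticeModels.zdGraph 3) 0 - (p : ℝ) < ε₀ → ∀ m : ℕ, (m : ℝ) ≤ c * (Literature.Probability.Percolation.criticalProb (Literature.Probability.LatticeModels.zdGraph 3) 0 - (p : ℝ)) ^ (-(3 : ℝ)) → c ≤ (Literature.Probability.Percolation.bondPercolation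 (Literature.Probability.LatticeModels.zdGraph 3) p).real {ω | (m : ℕ∞) ≤ (Literature.Probability.Percolation.openCluster ω 0).encard}

-- `IsoperimetryForcesCubeAnnouncement` holds: proved by `Summit.CriticalPhenomena.PercolationContinuityZ3.Theorems.PercLevelPieceIsoperimetryIsoperimetryForcesCubeAnnouncement.isoperimetryForcesCubeAnnouncement_proof` @ a6ae0b31789a (its module imports this route file, so no `_holds` link can be stated here).

/-- item stmt-CriticalPhenomena-4478 · support · rank 9 · closed · proved by Summit.CriticalPhenomena.PercolationContinuityZ3.Theorems.PercLevelPieceIsoperimetryCubeAnnouncementClosesRoute.cubeAnnouncementClosesRoute_proof @ 659d2b669b2c (prover) · by planner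
sources: Newman1986, Grimmett1999, AizenmanNewman1984
[support] GLUE 2 (provable now, ~250 lines): CUBE ANNOUNCEMENT → SubcritChiBelowCube →
PercolationContinuityZ3. Proof: if θ(p_c) > 0, Markov gives P_p(|C(0)| ≥ m) ≤ E_p|C(0)|/m = (sup_R
Σ_{B(R)} τ_p)/m ≤ C (p_c−p)^{−γ₀}/m (expClusterSize_eq_tsum / encard_eq_tsum_indicator in
SusceptibilityGammaOne.lean); with m ≍ c (p_c−p)^{−3} and γ₀ < 3 (w.l.o.g. γ₀ ≥ 0) the right side →
0 as p ↑ p_c (p_c > 0: criticalProb_zd_pos), contradicting ≥ c; hence θ(p_c) = 0, i.e.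
PercolationContinuityZ3 (percolationContinuityZ3_iff, measureReal_nonneg). [difficulty:
provable-now] -/
@[route_item "route-CriticalPhenomena-PercLevelPieceIsoperimetry"]
def CubeAnnouncementClosesRoute : Prop :=
  (0 < Literature.Probability.Percolation.theta (Literature.Probability.LatticeModels.zdGraph 3) 0 (Literature.Probability.Percolation.criticalProbI 3) → ∃ c : ℝ, 0 < c ∧ ∃ ε₀ : ℝ, 0 < ε₀ ∧ ∀ p : unitInterval, (p : ℝ) < Literature.Probability.Percolation.criticalProb (Literature.Probability.LatticeModels.zdGraph 3) 0 → Literature.Probability.Percolation.criticalProb (Literature.Probability.LatticeModels.zdGraph 3) 0 - (p : ℝ) < ε₀ → ∀ m : ℕ, (m : ℝ) ≤ c * (Literature.Probability.Percolation.criticalProb (Literature.Probability.LatticeModels.zdGraph 3) 0 - (p : ℝ)) ^ (-(3 : ℝ)) → c ≤ (Literature.Probability.Percolation.bondPercolation (Literature.Probability.LatticeModels.zdGraph 3) p).real {ω | (m : ℕ∞) ≤ (Literature.Probability.Percolation.openCluster ω 0).encard}) → SubcritChiBelowCube → PercolationContinuityZ3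

-- `CubeAnnouncementClosesRoute` holds: proved by `Summit.CriticalPhenomena.PercolationContinuityZ3.Theorems.PercLevelPieceIsoperimetryCubeAnnouncementClosesRoute.cubeAnnouncementClosesRoute_proof` @ 659d2b669b2c (its module imports this route file, so no `_holds` link can be stated here).

/-- item stmt-CriticalPhenomena-4479 · assembly · rank 1 · closed · proved by Summit.CriticalPhenomena.PercolationContinuityZ3.Theorems.PercLevelPieceIsoperimetryAssembly.assembly_proof @ 5586a73d16c7 (prover) · by planner
sources: Newman1986, Grimmett1999
[assembly] LevelPieceIsoperimetry → SubcritChiBelowCube → PercolationContinuityZ3. -/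
@[route_item "route-CriticalPhenomena-PercLevelPieceIsoperimetry"]
def Assembly : Prop :=
  LevelPieceIsoperimetry → SubcritChiBelowCube → PercolationContinuityZ3

-- `Assembly` holds: proved by `Summit.CriticalPhenomena.PercolationContinuityZ3.Theorems.PercLevelPieceIsoperimetryAssembly.assembly_proof` @ 5586a73d16c7 (its module imports this route file, so no `_holds` link can be stated here).

/-! D-0027 §2.1 — DECIDING THEOREM (planner-authored via `route open/edit --closes-file`; by planner-rbadge-CriticalPhenomena-PercLevelPiec-2ca110dc-g4-0 2026-08-15T16:08:46Z):
its hypotheses are this route's items and its conclusion the sub-problem Statement (glue_lint), and it elaborates with this file. -/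

@[closes "route-CriticalPhenomena-PercLevelPieceIsoperimetry"] theorem closes (hI : LevelPieceIsoperimetry) (hG : SubcritChiBelowCube)
    (hGlue₁ : IsoperimetryForcesCubeAnnouncement) (hGlue₂ : CubeAnnouncementClosesRoute) :
    _root_.PercolationContinuityZ3 :=
  hGlue₂ (hGlue₁ hI) hG

end Summit.CriticalPhenomena.PercolationContinuityZ3.Theses.PercLevelPieceIsoperimetry
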